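import Summits.Ventures.PercRepro.C025ProfileHallParallel
import Summits.Ventures.PercRepro.C025ProfileCases

/-!
# C-033 «SHADOW HALL (H⁺)» — the girth regime: the normalized matching property of the Boolean lattice (night-3 g7)

`hallIneq_of_girth`: for every finite matroid in which every subset with at most `u` elements is independent (girth
`≥ u + 1`) and every `q < u`, the Hall inequality `(H⁺_{q,u})` holds for every family of rank-`q` sets — the H⁺
analogue of g6's `profileIneq_of_girth` (C025ProfileCases) and the kernel form of the «free-matroid» regime of the
dossier (§2: H⁺ on the Boolean lattice is the normalized matching property / LYM).

The combinatorial core is self-contained (no `Fintype`): for a family `𝒜` of `q`-subsets of a finite set `E` with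
`n = #E`, its upper shadow at the level `r ≥ q` inside `E` (`upAt E r 𝒜`, the `r`-subsets of `E` containing a member)
satisfies `#𝒜 · C(n, r) ≤ #(upAt E r 𝒜) · C(n, q)` (`card_mul_choose_le_card_upAt_mul_choose`): one level at a time,
`#𝒞 · (n − r) ≤ #(upAt E (r+1) 𝒞) · (r+1)` by double counting the pairs `B ⊆ S` (`card_mul_le_card_upAt_succ_mul`:
every `B` has `n − r` upper neighbours `insert x B`, every `S` at most `r + 1` lower ones), and the shadows compose
(`upAt_succ_eq_upAt_upAt`); `C(n, r+1)·(r+1) = C(n, r)·(n − r)` closes the induction.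
In a matroid of girth `≥ u + 1` the rank-`q` sets are the `q`-subsets (`Rq_subset_powersetCard`), every `u`-subset has
rank `u` (`powersetCard_subset_levelSet`) and every price is at most `C(n,u)/C(n,q)` (`price_le_of_girth`).
-/

open scoped Matroid

namespace PercRepro

namespace Boolean

open Finset

variable {α : Type} [DecidableEq α]

/-- The upper shadow of `𝒜` at the level `r` inside `E`: the `r`-subsets of `E` containing a member of `𝒜`. -/
noncomputable def upAt (E : Finset α) (r : ℕ) (𝒜 : Finset (Finset α)) : Finset (Finset α) :=
  (E.powersetCard r).filter (fun S => ∃ B ∈ 𝒜, B ⊆ S)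

/-- Membership in `upAt`. -/
theorem mem_upAt {E : Finset α} {r : ℕ} {𝒜 : Finset (Finset α)} {S : Finset α} :
    S ∈ upAt E r 𝒜 ↔ (S ⊆ E ∧ S.card = r) ∧ ∃ B ∈ 𝒜, B ⊆ S := by
  unfold upAt
  rw [Finset.mem_filter, Finset.mem_powersetCard]

/-- At the level of the family itself the upper shadow is the family. -/
theorem upAt_self {E : Finset α} {q : ℕ} {𝒜 : Finset (Finset α)} (hA : 𝒜 ⊆ E.powersetCard q) :
    upAt E q 𝒜 = 𝒜 := by
  ext S
  rw [mem_upAt]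
  constructor
  · rintro ⟨⟨_, hSc⟩, B, hB, hBS⟩
    have hBc := (Finset.mem_powersetCard.1 (hA hB)).2
    rw [← Finset.eq_of_subset_of_card_le hBS (by rw [hSc, hBc])]
    exact hB
  · intro hS
    have h := Finset.mem_powersetCard.1 (hA hS)
    exact ⟨h, S, hS, subset_refl _⟩

/-- The upper shadows compose: the level `r + 1` above `𝒜` is the level `r + 1` above the level `r` (`q ≤ r`). -/
theorem upAt_succ_eq_upAt_upAt {E : Finset α} {q r : ℕ} {𝒜 : Finset (Finset α)} (hA : 𝒜 ⊆ E.powersetCard q)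
    (hqr : q ≤ r) : upAt E (r + 1) 𝒜 = upAt E (r + 1) (upAt E r 𝒜) := by
  ext S
  rw [mem_upAt, mem_upAt]
  constructor
  · rintro ⟨hS, B, hB, hBS⟩
    refine ⟨hS, ?_⟩
    have hBc := (Finset.mem_powersetCard.1 (hA hB)).2
    obtain ⟨T, hBT, hTS, hTc⟩ :=
      Finset.exists_subsuperset_card_eq (n := r) hBS (by rw [hBc]; exact hqr) (by rw [hS.2]; omega)
    exact ⟨T, by rw [mem_upAt]; exact ⟨⟨hTS.trans hS.1, hTc⟩, B, hB, hBT⟩, hTS⟩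
  · rintro ⟨hS, T, hT, hTS⟩
    rw [mem_upAt] at hT
    obtain ⟨_, B, hB, hBT⟩ := hT
    exact ⟨hS, B, hB, hBT.trans hTS⟩

/-- **One level of the normalized matching property**: for a family `𝒞` of `r`-subsets of `E`,
`#𝒞 · (#E − r) ≤ #(upAt E (r+1) 𝒞) · (r + 1)`. -/
theorem card_mul_le_card_upAt_succ_mul {E : Finset α} {r : ℕ} {𝒞 : Finset (Finset α)} (hC : 𝒞 ⊆ E.powersetCard r) :
    𝒞.card * (E.card - r) ≤ (upAt E (r + 1) 𝒞).card * (r + 1) := by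
  classical
  refine Finset.card_mul_le_card_mul (fun B S => B ⊆ S) ?_ ?_
  · -- every member has at least #E − r upper neighbours: insert x B, x ∈ E ∖ B
    intro B hB
    have hBE := Finset.mem_powersetCard.1 (hC hB)
    have himg : (E \ B).image (fun x => insert x B) ⊆ (upAt E (r + 1) 𝒞).bipartiteAbove (fun B S => B ⊆ S) B := by
      intro S hS
      rw [Finset.mem_image] at hS
      obtain ⟨x, hx, rfl⟩ := hS
      rw [Finset.mem_sdiff] at hx
      rw [Finset.mem_bipartiteAbove, mem_upAt]
      refine ⟨⟨⟨Finset.insert_subset hx.1 hBE.1, ?_⟩, B, hB, Finset.subset_insert _ _⟩, Finset.subset_insert _ _⟩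
      rw [Finset.card_insert_of_notMem hx.2, hBE.2]
    have hinj : Set.InjOn (fun x => insert x B) (E \ B : Finset α) := by
      intro x hx y hy hxy
      rw [Finset.mem_coe, Finset.mem_sdiff] at hx hy
      simp only at hxy
      have : x ∈ insert y B := by rw [← hxy]; exact Finset.mem_insert_self _ _
      rw [Finset.mem_insert] at this
      rcases this with h | h
      · exact h
      · exact absurd h hx.2
    calc E.card - r = (E \ B).card := by rw [Finset.card_sdiff_of_subset hBE.1, hBE.2]
      _ = ((E \ B).image (fun x => insert x B)).card := (Finset.card_image_of_injOn hinj).symm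
      _ ≤ ((upAt E (r + 1) 𝒞).bipartiteAbove (fun B S => B ⊆ S) B).card := Finset.card_le_card himg
  · -- every set of the upper shadow has at most r + 1 members below it
    intro S hS
    rw [mem_upAt] at hS
    have hsub : 𝒞.bipartiteBelow (fun B S => B ⊆ S) S ⊆ S.powersetCard r := by
      intro B hB
      rw [Finset.mem_bipartiteBelow] at hB
      rw [Finset.mem_powersetCard]
      exact ⟨hB.2, (Finset.mem_powersetCard.1 (hC hB.1)).2⟩
    calc (𝒞.bipartiteBelow (fun B S => B ⊆ S) S).card ≤ (S.powersetCard r).card := Finset.card_le_card hsub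
      _ = Nat.choose (r + 1) r := by rw [Finset.card_powersetCard, hS.1.2]
      _ = r + 1 := by rw [Nat.choose_succ_self_right]

/-- **The normalized matching property of the Boolean lattice** (upper shadows): for a family `𝒜` of `q`-subsets of
`E` and every `k`, `#𝒜 · C(#E, q + k) ≤ #(upAt E (q + k) 𝒜) · C(#E, q)`. -/
theorem card_mul_choose_le_card_upAt_mul_choose {E : Finset α} {q : ℕ} {𝒜 : Finset (Finset α)}
    (hA : 𝒜 ⊆ E.powersetCard q) (k : ℕ) :
    𝒜.card * Nat.choose E.card (q + k) ≤ (upAt E (q + k) 𝒜).card * Nat.choose E.card q := by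
  induction k with
  | zero =>
    rw [Nat.add_zero, upAt_self hA]
  | succ k ih =>
    set r := q + k with hr
    have hC : upAt E r 𝒜 ⊆ E.powersetCard r := by
      intro S hS; rw [mem_upAt] at hS; rw [Finset.mem_powersetCard]; exact hS.1
    have hstep := card_mul_le_card_upAt_succ_mul hC
    rw [← upAt_succ_eq_upAt_upAt hA (by omega)] at hstep
    have hid := Nat.choose_succ_right_eq E.card r   -- C(n, r+1)·(r+1) = C(n, r)·(n − r)
    have hr1 : q + (k + 1) = r + 1 := by omega
    rw [hr1]
    -- multiply the claim by (r + 1) > 0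
    apply Nat.le_of_mul_le_mul_right _ (Nat.succ_pos r)
    calc 𝒜.card * Nat.choose E.card (r + 1) * (r + 1)
        = 𝒜.card * (Nat.choose E.card (r + 1) * (r + 1)) := by ring
      _ = 𝒜.card * (Nat.choose E.card r * (E.card - r)) := by rw [hid]
      _ = (𝒜.card * Nat.choose E.card r) * (E.card - r) := by ring
      _ ≤ ((upAt E r 𝒜).card * Nat.choose E.card q) * (E.card - r) := Nat.mul_le_mul_right _ ih
      _ = ((upAt E r 𝒜).card * (E.card - r)) * Nat.choose E.card q := by ring
      _ ≤ ((upAt E (r + 1) 𝒜).card * (r + 1)) * Nat.choose E.card q := Nat.mul_le_mul_right _ hstep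
      _ = (upAt E (r + 1) 𝒜).card * Nat.choose E.card q * (r + 1) := by ring

end Boolean

open Set Finset ThmH

section HallGirth

variable {α : Type} [DecidableEq α] {M : Matroid α} [M.Finite]

/-- **`(H⁺_{q,u})` for every matroid of girth `≥ u + 1`** (every subset with at most `u` elements independent), every
`q < u` and every family of rank-`q` sets — the normalized matching property of the Boolean lattice. -/
theorem hallIneq_of_girth {q u : ℕ} (hg : ∀ T ⊆ M.E, T.encard ≤ u → M.Indep T) (hqu : q < u) :
    Profile.HallIneq M q u := by
  intro 𝒜 h𝒜
  set n := (gr M).card with hn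
  have hAq : 𝒜 ⊆ (gr M).powersetCard q := h𝒜.trans (Rq_subset_powersetCard hg hqu)
  -- the Boolean upper shadow at level u lies in the matroid shadow
  have hsub : Boolean.upAt (gr M) u 𝒜 ⊆ Shadow.shadowLevel M u 𝒜 := by
    intro S hS
    rw [Boolean.mem_upAt] at hS
    rw [mem_shadowLevel]
    refine ⟨powersetCard_subset_levelSet hg (Finset.mem_powersetCard.2 hS.1), hS.2⟩
  obtain ⟨k, hk⟩ : ∃ k, u = q + k := ⟨u - q, by omega⟩
  have hnmp := Boolean.card_mul_choose_le_card_upAt_mul_choose hAq k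
  rw [← hk] at hnmp
  by_cases hAe : 𝒜 = ∅
  · subst hAe
    simp only [Finset.sum_empty]
    exact Nat.cast_nonneg _
  · obtain ⟨B₀, hB₀⟩ := Finset.nonempty_iff_ne_empty.2 hAe
    have hqn : q ≤ n := by
      have h := Finset.mem_powersetCard.1 (hAq hB₀)
      rw [← h.2]; exact Finset.card_le_card h.1
    have hq : (0 : ℚ) < Nat.choose n q := by exact_mod_cast Nat.choose_pos hqn
    calc ∑ B ∈ 𝒜, Profile.price M q u B
        ≤ ∑ _B ∈ 𝒜, (Nat.choose n u : ℚ) / (Nat.choose n q : ℚ) :=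
          Finset.sum_le_sum (fun B hB => price_le_of_girth hg hqu (h𝒜 hB))
      _ = (𝒜.card : ℚ) * ((Nat.choose n u : ℚ) / (Nat.choose n q : ℚ)) := by
          rw [Finset.sum_const, nsmul_eq_mul]
      _ ≤ ((Boolean.upAt (gr M) u 𝒜).card : ℚ) := by
          rw [← mul_div_assoc, div_le_iff₀ hq]
          exact_mod_cast hnmp
      _ ≤ ((Shadow.shadowLevel M u 𝒜).card : ℚ) := by exact_mod_cast Finset.card_le_card hsub

end HallGirth

end PercRepro
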